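import Summits.CriticalPhenomena.PercolationContinuityZ3.Theorems.PercNearOneGluingNoHeavyLowerTailAntitheticZones
import Summits.CriticalPhenomena.PercolationContinuityZ3.Theorems.PercNearOneGluingNoHeavyLowerTailAntitheticLobes
import Summits.CriticalPhenomena.PercolationContinuityZ3.Theorems.PercNearOneGluingNoHeavyLowerTailAntitheticLatticePieces
import HarnessLib

/-!
# `NoHeavyLowerTail` (stmt-CriticalPhenomena-4575) — antithetic cluster pairs: THEOREM D — the DISJOINT SLICE `W ∩ W' = {s}` of
# the antithetic sum is nonnegative on EVERY finite graph, with sinks (prim-hp-2 gen 31/36; MEMO-gen31 §1e,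
# THEOREM-D-disjoint-slice.md, MEMO-gen36 §3)

Support file (`--supports stmt-CriticalPhenomena-4575`, hull-port prover `prim-hp-2`, gen 36).  No named facts, no sorries; standard
axioms.  The `def`s (`Antithetic.Slice.*`) are proof-internal bookkeeping; the theorem `Antithetic.slice_nonneg` is stated without them.

SETTING as in `…AntitheticCones`: colourings `ω ⊆ Sym2 V` (`ω ∩ E` red, `ωᶜ ∩ E` blue), source `s`, red / blue (edge) clusters of `s`,
`Δ(ω) = (F(red) − F(blue))(G(red) − G(blue))` for increasing `F, G`; `W, W'` the red / blue vertex clusters, `U = W ∪ W'`.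

THEOREM D (gen 31, proved here as a tree theorem).  For EVERY finite edge set `E`, source `s`, sink set `X` and increasing `F, G`:
`0 ≤ Σ_{ω : W ∩ W' = {s}, U ∩ X = ∅} Δ(ω)` — the slice "no vertex other than `s` is joined to `s` in both colours" of the conjectured
antithetic BHK inequality SC (and of BIC with `R = V ∖ {s}`) is nonnegative on every graph.  (If `s` lies on no cycle of `G − X` the
slice is the whole constraint set, so SC(G,X) holds there: COROLLARY D1 of the memo, not formalised.)

PROOF (THEOREM-D-disjoint-slice.md, in the block-algebra form of gen 36).  For `T` in the slice the LOBES are the components of `G[U ∖ s]`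
(clusters of the configuration "edges of `E` with both endpoints in `U ∖ s`"); each lobe is monochromatic (`Slice.red_iff_of_reach`), its
edges to `s` carry its colour and its edges to `V ∖ U` the other colour (`Slice.outer_edge`), and distinct lobes are not adjacent.  Blocks
`S(K) = {e ∈ E : e meets K}`, block algebra `𝒜`, top `N` (every lobe red-attached, everything else red), part `{N ∆ A : A ∈ 𝒜}`.  Validity
and membership in the slice are SEALING arguments for the set (lobes inside `A`) ∪ (V ∖ U) (`Slice.sealed`, `Slice.red_antitone`,
`Slice.mem_slice_of_mem_lpart`); constancy of parts needs in addition that an up lobe IS red-reached, by an `s`-avoiding path inside the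
lobe (`Slice.walk_lobe`, `Slice.red_reach_of_up`), whence `U`, the lobes, the algebra and the top are the same for all members
(`Slice.lpart_eq_of_mem`); Harris on `𝒜` (`piece_algebra_sum_nonneg`) and the partition principle (`sum_nonneg_of_parts`) finish.
[cite: VandenbergHaggstromKahn2005, §1 p. 6 ("Harris' inequality"), §1 p. 3 (open cluster `C_s`)]
-/

noncomputable section

namespace Summit.CriticalPhenomena.PercolationContinuityZ3.Theorems

open Literature.Probability.Percolation
open scoped Classical symmDiff

namespace Antithetic

namespace Slice

variable {V : Type*}

section Main

variable {E : Set (Sym2 V)} {s : V} {T : Set (Sym2 V)}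

/-- **Validity** (THEOREM-D-disjoint-slice.md, Lemma 2(c)): along the block algebra the red edge cluster of `N ∆ A` is antitone. [this work] -/
theorem red_antitone (hI : ∀ v, v ≠ s → ¬ ((openGraph (T ∩ E)).Reachable s v ∧ (openGraph (Tᶜ ∩ E)).Reachable s v))
    {A B : Set (Sym2 V)} (hB : B ∈ lalg E s T) (hAB : A ⊆ B) :
    openEdgeCluster ((ltop E s T ∆ B) ∩ E) s ⊆ openEdgeCluster ((ltop E s T ∆ A) ∩ E) s := by
  refine openEdgeCluster_subset_of_sealed_le _ _ s (sealedSet E s T B) (apex_not_mem_sealedSet B) ?_ (sealed hI hB)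
  intro x y hx hy hxy
  refine ⟨?_, hxy.2⟩
  have heB := hxy.1
  rw [Set.mem_symmDiff] at heB ⊢
  by_cases heA : s(x, y) ∈ A
  · exact Or.inr ⟨heA, fun hn => by rcases heB with ⟨_, h⟩ | ⟨_, h⟩ <;> [exact h (hAB heA); exact h hn]⟩
  · by_cases heB' : s(x, y) ∈ B
    · exfalso
      have hnN : s(x, y) ∉ ltop E s T := by
        rcases heB with ⟨_, h⟩ | ⟨_, h⟩
        · exact absurd heB' h
        · exact h
      have hex : ∃ v ∈ uni E s T \ {s}, s(x, y) ∈ lblock E s T v := by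
        by_contra hcon
        apply hnN
        intro v hv hev
        exact absurd ⟨v, hv, hev⟩ hcon
      obtain ⟨v, hv, hev⟩ := hex
      have hvB : lblock E s T v ⊆ B := by
        rcases hB v hv with h | h
        · exact h
        · exact absurd (Set.disjoint_left.1 h hev) (not_not.2 heB')
      obtain ⟨-, z, hz, hze⟩ := hev
      rcases Sym2.mem_iff.1 hze with rfl | rfl
      · exact hx (Or.inl ⟨v, hv, hvB, hz⟩)
      · exact hy (Or.inl ⟨v, hv, hvB, hz⟩)
    · rcases heB with ⟨h, _⟩ | ⟨h, _⟩
      · exact Or.inl ⟨h, heA⟩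
      · exact absurd h heB'

/-- Red reach of a member stays outside the sealed set. [this work] -/
theorem not_mem_sealedSet_of_reach (hI : ∀ v, v ≠ s → ¬ ((openGraph (T ∩ E)).Reachable s v ∧ (openGraph (Tᶜ ∩ E)).Reachable s v))
    {B : Set (Sym2 V)} (hB : B ∈ lalg E s T) {v : V} (hv : (openGraph ((ltop E s T ∆ B) ∩ E)).Reachable s v) :
    v ∉ sealedSet E s T B :=
  (reachable_of_sealed _ _ s (sealedSet E s T B) (apex_not_mem_sealedSet B) (fun _ _ _ _ => Iff.rfl) (sealed hI hB) hv).2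

/-- **Walks inside a lobe.**  A walk to `w` in the colour `η` through vertices of `U ∖ s` runs inside the lobe of `w`, and is open in
any colouring `M` that agrees with `η` on the lobe block of `w`. [this work] -/
theorem walk_lobe {η M : Set (Sym2 V)} {w : V}
    (hM : ∀ e ∈ lblock E s T w, (e ∈ M ↔ e ∈ η)) :
    ∀ {a : V} (p : (openGraph (η ∩ E)).Walk a w), (∀ v ∈ p.support, v ∈ uni E s T ∧ v ≠ s) →
      a ∈ lobe E s T w ∧ (openGraph (M ∩ E)).Reachable a w := by
  intro a p
  induction p with
  | nil => exact fun _ => ⟨mem_lobe_self _, SimpleGraph.Reachable.refl _⟩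
  | @cons a b c hab p' ih =>
    intro hsupp
    have ha := hsupp a (by simp)
    have hb := hsupp b (by simp)
    obtain ⟨hbl, hbr⟩ := ih hM fun v hv => hsupp v (by simp [hv])
    rw [openGraph_adj] at hab
    have hin : s(a, b) ∈ inner E s T := by
      refine ⟨hab.1.2, fun v hv => ?_⟩
      rcases Sym2.mem_iff.1 hv with rfl | rfl
      · exact ha
      · exact hb
    have hal : a ∈ lobe E s T c := mem_lobe_of_adj hbl (by rw [Sym2.eq_swap]; exact hin) hab.2.symm
    have heM : s(a, b) ∈ M := (hM _ ⟨hab.1.2, b, hbl, Sym2.mem_mk_right a b⟩).2 hab.1.1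
    exact ⟨hal, ((openGraph_adj (M ∩ E) a b).2 ⟨⟨heM, hab.1.2⟩, hab.2⟩).reachable.trans hbr⟩

/-- A path from `s` to `w` in colour `η ∈ {T, Tᶜ}` becomes a red path of any `M` agreeing with `η` on the lobe block of `w`. [this work] -/
theorem reach_of_path {η M : Set (Sym2 V)} {w : V} (hws : w ≠ s)
    (hη : ∀ v, (openGraph (η ∩ E)).Reachable s v → v ∈ uni E s T)
    (hM : ∀ e ∈ lblock E s T w, (e ∈ M ↔ e ∈ η)) (hw : (openGraph (η ∩ E)).Reachable s w) :
    (openGraph (M ∩ E)).Reachable s w := by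
  obtain ⟨q⟩ := hw
  set p := q.bypass with hp
  have hpath : p.IsPath := q.bypass_isPath
  have hnodup : p.support.Nodup := hpath.support_nodup
  have hU : ∀ v ∈ p.support, v ∈ uni E s T := fun v hv => by
    obtain ⟨r, -, -⟩ := SimpleGraph.Walk.mem_support_iff_exists_append.1 hv
    exact hη v ⟨r⟩
  clear_value p
  clear hp hpath q
  cases p with
  | nil => exact absurd rfl hws
  | @cons _ b _ h p' =>
    rw [SimpleGraph.Walk.support_cons, List.nodup_cons] at hnodup
    have hsupp : ∀ v ∈ p'.support, v ∈ uni E s T ∧ v ≠ s := fun v hv =>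
      ⟨hU v (by rw [SimpleGraph.Walk.support_cons]; exact List.mem_cons_of_mem _ hv), fun hvs => hnodup.1 (hvs ▸ hv)⟩
    obtain ⟨hbl, hbr⟩ := walk_lobe hM p' hsupp
    rw [openGraph_adj] at h
    have heM : s(s, b) ∈ M := (hM _ ⟨h.1.2, b, hbl, Sym2.mem_mk_right s b⟩).2 h.1.1
    exact ((openGraph_adj (M ∩ E) s b).2 ⟨⟨heM, h.1.2⟩, h.2⟩).reachable.trans hbr

/-- **Up lobes are red-reached**: in the member `N ∆ A`, a vertex of `U ∖ s` whose lobe block is disjoint from `A` is joined to `s` in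
red (THEOREM-D-disjoint-slice.md, Lemma 2(b)). [this work] -/
theorem red_reach_of_up (hI : ∀ v, v ≠ s → ¬ ((openGraph (T ∩ E)).Reachable s v ∧ (openGraph (Tᶜ ∩ E)).Reachable s v))
    {A : Set (Sym2 V)} {w : V} (hw : w ∈ uni E s T ∧ w ≠ s) (hdis : Disjoint (lblock E s T w) A) :
    (openGraph ((ltop E s T ∆ A) ∩ E)).Reachable s w := by
  -- on the block of `w`, `N ∆ A = N`, and `N = T` or `Tᶜ` according to the colour of `w`
  have hMN : ∀ e ∈ lblock E s T w, (e ∈ ltop E s T ∆ A ↔ e ∈ ltop E s T) := fun e he => by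
    rw [Set.mem_symmDiff]
    have := Set.disjoint_left.1 hdis he
    exact ⟨fun h => h.elim (fun h => h.1) (fun h => absurd h.1 this), fun h => Or.inl ⟨h, this⟩⟩
  by_cases hred : (openGraph (T ∩ E)).Reachable s w
  · refine reach_of_path hw.2 (fun v hv => Or.inl hv) (fun e he => ?_) hred
    rw [hMN e he, mem_ltop_iff hI hw he]
    tauto
  · have hblue : (openGraph (Tᶜ ∩ E)).Reachable s w := hw.1.resolve_left hred
    refine reach_of_path hw.2 (fun v hv => Or.inr hv) (fun e he => ?_) hblue
    rw [hMN e he, mem_ltop_iff hI hw he, Set.mem_compl_iff]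
    tauto

/-- **Parts lie in the slice and respect the sinks.** [this work] -/
theorem mem_slice_of_mem_lpart [Fintype V] {X : Set V}
    (hI : ∀ v, v ≠ s → ¬ ((openGraph (T ∩ E)).Reachable s v ∧ (openGraph (Tᶜ ∩ E)).Reachable s v))
    (hX : ∀ x ∈ X, ¬ (openGraph (T ∩ E)).Reachable s x ∧ ¬ (openGraph (Tᶜ ∩ E)).Reachable s x)
    {M : Set (Sym2 V)} (hM : M ∈ lpart E s T) :
    (∀ v, v ≠ s → ¬ ((openGraph (M ∩ E)).Reachable s v ∧ (openGraph (Mᶜ ∩ E)).Reachable s v)) ∧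
      (∀ x ∈ X, ¬ (openGraph (M ∩ E)).Reachable s x ∧ ¬ (openGraph (Mᶜ ∩ E)).Reachable s x) := by
  rw [lpart, Finset.mem_image] at hM
  obtain ⟨A, hA, rfl⟩ := hM
  rw [Finset.mem_filter] at hA
  have hA := hA.2
  have hAc : Aᶜ ∈ lalg E s T := blockAlgebra_compl _ _ hA
  have hcomp : (ltop E s T ∆ A)ᶜ ∩ E = (ltop E s T ∆ Aᶜ) ∩ E := by rw [compl_symmDiff_eq]
  have hred : ∀ v, (openGraph ((ltop E s T ∆ A) ∩ E)).Reachable s v → v ∉ sealedSet E s T A :=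
    fun v hv => not_mem_sealedSet_of_reach hI hA hv
  have hblue : ∀ v, (openGraph ((ltop E s T ∆ A)ᶜ ∩ E)).Reachable s v → v ∉ sealedSet E s T Aᶜ := fun v hv => by
    rw [hcomp] at hv
    exact not_mem_sealedSet_of_reach hI hAc hv
  constructor
  · rintro v hvs ⟨hr, hb⟩
    have hvU : v ∈ uni E s T := by
      by_contra h
      exact hred v hr (Or.inr h)
    rcases hA v ⟨hvU, hvs⟩ with h | h
    · exact hred v hr (Or.inl ⟨v, ⟨hvU, hvs⟩, h, mem_lobe_self v⟩)
    · exact hblue v hb (Or.inl ⟨v, ⟨hvU, hvs⟩, Set.subset_compl_iff_disjoint_right.2 h, mem_lobe_self v⟩)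
  · intro x hx
    have hxU : x ∉ uni E s T := fun h => h.elim (hX x hx).1 (hX x hx).2
    exact ⟨fun h => hred x h (Or.inr hxU), fun h => hblue x h (Or.inr hxU)⟩

/-- **Parts are constant on themselves**: every member of the part of `T` has the same `U`, lobes, algebra, top and part. [this work] -/
theorem lpart_eq_of_mem [Fintype V]
    (hI : ∀ v, v ≠ s → ¬ ((openGraph (T ∩ E)).Reachable s v ∧ (openGraph (Tᶜ ∩ E)).Reachable s v))
    {M : Set (Sym2 V)} (hM : M ∈ lpart E s T) : lpart E s M = lpart E s T := by
  rw [lpart, Finset.mem_image] at hM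
  obtain ⟨A, hA, rfl⟩ := hM
  rw [Finset.mem_filter] at hA
  have hA := hA.2
  have hAc : Aᶜ ∈ lalg E s T := blockAlgebra_compl _ _ hA
  have hcomp : (ltop E s T ∆ A)ᶜ ∩ E = (ltop E s T ∆ Aᶜ) ∩ E := by rw [compl_symmDiff_eq]
  -- red reach of a member = `s` and the up lobes; blue reach = `s` and the down lobes
  have hup : ∀ w, w ∈ uni E s T ∧ w ≠ s →
      ((openGraph ((ltop E s T ∆ A) ∩ E)).Reachable s w ↔ Disjoint (lblock E s T w) A) := by
    intro w hw
    constructor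
    · intro h
      have hns := not_mem_sealedSet_of_reach hI hA h
      rcases hA w hw with h' | h'
      · exact absurd (Or.inl ⟨w, hw, h', mem_lobe_self w⟩) hns
      · exact h'
    · exact red_reach_of_up hI hw
  have hdown : ∀ w, w ∈ uni E s T ∧ w ≠ s →
      ((openGraph ((ltop E s T ∆ A)ᶜ ∩ E)).Reachable s w ↔ lblock E s T w ⊆ A) := by
    intro w hw
    rw [hcomp, ← Set.disjoint_compl_right_iff_subset]
    constructor
    · intro h
      have hns := not_mem_sealedSet_of_reach hI hAc h
      rcases hAc w hw with h' | h'
      · exact absurd (Or.inl ⟨w, hw, h', mem_lobe_self w⟩) hns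
      · exact h'
    · exact red_reach_of_up hI hw
  -- same `U`
  have huni : uni E s (ltop E s T ∆ A) = uni E s T := by
    ext v
    constructor
    · rintro (h | h)
      · by_contra hv
        exact not_mem_sealedSet_of_reach hI hA h (Or.inr hv)
      · rw [hcomp] at h
        by_contra hv
        exact not_mem_sealedSet_of_reach hI hAc h (Or.inr hv)
    · intro hv
      by_cases hvs : v = s
      · subst hvs
        exact apex_mem_uni
      · rcases hA v ⟨hv, hvs⟩ with h | h
        · exact Or.inr ((hdown v ⟨hv, hvs⟩).2 h)
        · exact Or.inl ((hup v ⟨hv, hvs⟩).2 h)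
  have hinner : inner E s (ltop E s T ∆ A) = inner E s T := by
    simp only [inner, huni]
  have hlobe : ∀ x, lobe E s (ltop E s T ∆ A) x = lobe E s T x := fun x => by
    simp only [lobe, hinner]
  have hblk : ∀ x, lblock E s (ltop E s T ∆ A) x = lblock E s T x := fun x => by
    simp only [lblock, hlobe]
  have halg : ∀ B, B ∈ lalg E s (ltop E s T ∆ A) ↔ B ∈ lalg E s T := fun B => by
    simp only [lalg, huni, hblk, Set.mem_setOf_eq]
  -- same top
  have htop : ltop E s (ltop E s T ∆ A) = ltop E s T := by
    ext e
    show (∀ x ∈ uni E s (ltop E s T ∆ A) \ {s}, e ∈ lblock E s (ltop E s T ∆ A) x →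
        (e ∈ ltop E s T ∆ A ↔ (openGraph ((ltop E s T ∆ A) ∩ E)).Reachable s x)) ↔
      (∀ x ∈ uni E s T \ {s}, e ∈ lblock E s T x → (e ∈ T ↔ (openGraph (T ∩ E)).Reachable s x))
    rw [huni]
    refine forall₂_congr fun w hw => ?_
    have hw' : w ∈ uni E s T ∧ w ≠ s := hw
    rw [hblk w]
    refine imp_congr_right fun he => ?_
    rcases hA w hw with h | h
    · -- down lobe: not red-reached in the member; member = complement of the top on the block
      have hnr : ¬ (openGraph ((ltop E s T ∆ A) ∩ E)).Reachable s w := fun hr =>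
        Set.disjoint_left.1 ((hup w hw').1 hr) he (h he)
      have h1 : (e ∈ ltop E s T ∆ A ↔ e ∉ ltop E s T) := by
        rw [Set.mem_symmDiff]
        have := h he
        exact ⟨fun h' => h'.elim (fun h' => absurd this h'.2) (fun h' => h'.2), fun h' => Or.inr ⟨this, h'⟩⟩
      rw [mem_ltop_iff hI hw' he] at h1
      simp only [hnr, iff_false]
      rw [h1, not_not]
    · -- up lobe: red-reached; member = top on the block
      have hr : (openGraph ((ltop E s T ∆ A) ∩ E)).Reachable s w := (hup w hw').2 h
      have h1 : (e ∈ ltop E s T ∆ A ↔ e ∈ ltop E s T) := by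
        rw [Set.mem_symmDiff]
        have := Set.disjoint_left.1 h he
        exact ⟨fun h' => h'.elim (fun h' => h'.1) (fun h' => absurd h'.1 this), fun h' => Or.inl ⟨h', this⟩⟩
      rw [mem_ltop_iff hI hw' he] at h1
      simp only [hr, iff_true]
      exact h1
  -- conclude
  rw [lpart, lpart, htop]
  congr 1
  ext B
  simp only [Finset.mem_filter, Finset.mem_univ, true_and]
  exact halg B

/-- **Every part has a nonnegative antithetic sum** (Harris on the block algebra + validity). [this work] -/
theorem lpart_sum_nonneg [Fintype V]
    (hI : ∀ v, v ≠ s → ¬ ((openGraph (T ∩ E)).Reachable s v ∧ (openGraph (Tᶜ ∩ E)).Reachable s v))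
    {F G : Set (Sym2 V) → ℝ} (hF : Monotone F) (hG : Monotone G) :
    0 ≤ ∑ M ∈ lpart E s T, (F (openEdgeCluster (M ∩ E) s) - F (openEdgeCluster (Mᶜ ∩ E) s)) *
      (G (openEdgeCluster (M ∩ E) s) - G (openEdgeCluster (Mᶜ ∩ E) s)) := by
  rw [lpart]
  refine piece_algebra_sum_nonneg E s (ltop E s T) _ ?_ ?_ ?_ ?_ ?_ hF hG
  · intro A hA B hB
    rw [Finset.mem_filter] at hA hB ⊢
    exact ⟨Finset.mem_univ _, blockAlgebra_inter _ (lblock E s T) hA.2 hB.2⟩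
  · intro A hA B hB
    rw [Finset.mem_filter] at hA hB ⊢
    exact ⟨Finset.mem_univ _, blockAlgebra_union _ (lblock E s T) hA.2 hB.2⟩
  · intro A hA
    rw [Finset.mem_filter] at hA ⊢
    exact ⟨Finset.mem_univ _, blockAlgebra_compl _ (lblock E s T) hA.2⟩
  · rw [Finset.mem_filter]
    exact ⟨Finset.mem_univ _, blockAlgebra_empty _ (lblock E s T)⟩
  · intro A hA B hB hAB
    rw [Finset.mem_filter] at hB
    exact red_antitone hI hB.2 hAB

end Main

end Slice

/-! ## THEOREM D -/
section TheoremD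

variable {V : Type*} [Fintype V]

/-- **THEOREM D (prim-hp-2 gen 31/36): the disjoint slice of the antithetic BHK sum is nonnegative on every finite graph.**  For every edge
set `E` on a finite vertex type, source `s`, sink set `X` and increasing `F, G` of the edge cluster:
`0 ≤ Σ_{ω : (no v ≠ s is joined to s both in ω ∩ E and in ωᶜ ∩ E) ∧ (no x ∈ X is joined to s in either)}
(F(C_s(ω∩E)) − F(C_s(ωᶜ∩E))) · (G(C_s(ω∩E)) − G(C_s(ωᶜ∩E)))` — i.e. conditioned on `W ∩ W' = {s}` and `(W ∪ W') ∩ X = ∅` the red and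
blue clusters of `s` are concordant on average; in particular `BIC_G(V ∖ {s}) ≥ 0` for every graph.  Proof: lobe partition (module
docstring). [this work] -/
theorem slice_nonneg (E : Set (Sym2 V)) (s : V) (X : Set V) {F G : Set (Sym2 V) → ℝ} (hF : Monotone F) (hG : Monotone G) :
    0 ≤ ∑ ω ∈ Finset.univ.filter (fun ω : Set (Sym2 V) =>
        (∀ v, v ≠ s → ¬ ((openGraph (ω ∩ E)).Reachable s v ∧ (openGraph (ωᶜ ∩ E)).Reachable s v)) ∧
          (∀ x ∈ X, ¬ (openGraph (ω ∩ E)).Reachable s x ∧ ¬ (openGraph (ωᶜ ∩ E)).Reachable s x)),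
      (F (openEdgeCluster (ω ∩ E) s) - F (openEdgeCluster (ωᶜ ∩ E) s)) *
        (G (openEdgeCluster (ω ∩ E) s) - G (openEdgeCluster (ωᶜ ∩ E) s)) := by
  refine sum_nonneg_of_parts _ _ (Slice.lpart E s) ?_ ?_ ?_ ?_
  · intro T hT
    rw [Finset.mem_filter] at hT
    exact Slice.mem_lpart_self hT.2.1
  · intro T hT M hM
    rw [Finset.mem_filter] at hT ⊢
    exact ⟨Finset.mem_univ _, Slice.mem_slice_of_mem_lpart hT.2.1 hT.2.2 hM⟩
  · intro T hT M hM
    rw [Finset.mem_filter] at hT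
    exact Slice.lpart_eq_of_mem hT.2.1 hM
  · intro T hT
    rw [Finset.mem_filter] at hT
    exact Slice.lpart_sum_nonneg hT.2.1 hF hG

end TheoremD

end Antithetic

end Summit.CriticalPhenomena.PercolationContinuityZ3.Theorems
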